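import Summits.QuantumFields.YangMills.Theorems.UnitScaleTiltProp7FlatDatum
import HarnessLib

/-!
# Route `UnitScaleTilt`, crux K1 «MinimiserStabilityRegPr» (stmt-QuantumFields-19200), registered stub `stub_prop7From14` (leaf V3 «Prop 7 from a
# background (14)») — **BOTH CLAUSES OF THE REGISTERED TEXT ARE INVARIANT UNDER COARSE GAUGE TRANSFORMATIONS OF THE DATUM `V ↦ V^{w}`**, hence hold
# at EVERY PURE-GAUGE DATUM `V = 1^{w}` (for every `ε₀`, `ε₁`)

Cell `ym3-torus` ∕ fleet seat `ym-ust-19200-p1` (gen 6).  [Balaban1985Variational] p. 278 / Sect. G p. 305 treat the datum `V` up to gauge («V = V′V₀»,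
axial gauge for `V′`); at the T³ carrier (`T3Thm1Carrier.varProblem3`) this freedom is the following kernel-checked EQUIVARIANCE of every notion of
the stub under the FULL gauge group of run `K`'s finest lattice acting on pairs `(V, U) ↦ (V^{u↓}, U^{u})` (`u↓ = T3PrintedRegularOrbits.descTransf`):
`InU` (`regPr_gaugeAct_iff`), `InB` (`gaugeAct_mem_fibre_iff`), `Reg7` (`plaqSmall_gaugeAct_iff'`) are in the tree; here (§1) reading R2's `IsCritical`
(`isCritR2_gaugeAct_iff`), print's group-(4) orbit relation (`sameOrbit_gaugeAct_iff`: conjugation `v ↦ u v u⁻¹` preserves `v↓ = 1`) and reading R1's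
`OnMinimalOrbit` (`onMinimalOrbit_gaugeAct_iff`); (§2) **`atMostOneCriticalOrbit_gaugeAct_iff`** and **`exists_onMinimalOrbit_gaugeAct_iff`** — the two
CLAUSES of Prop. 7 for the datum `V^{u↓}` ⟺ for `V`; with the lift `liftTransfTo` (`(lift w)↓ = w`) every coarse `w` is a `u↓`, so both clauses depend
on the datum only through its gauge orbit (`…_coarse_iff`).  (§3) COROLLARY with the sibling `Prop7FlatDatum`: **both clauses of the registered text
hold at every pure-gauge datum `V = 1^{w}`**, for every member, every `ε₀` and every radius (`prop7_clauses_pureGauge`), and the stub's text with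
`V := 1^{w}` (`prop7From14_pureGaugeDatum`).  Sorry-free, no definitions, nothing of Bałaban's analysis used.

References: T. Bałaban, CMP 102 (1985) 277–309 [Balaban1985Variational] ((4)–(6) p.278, Prop. 7 p.299, (170)–(172) p.305); CMP 98 (1985) 17–51
[Balaban1985Averaging] ((8)–(13) pp.18–19).
-/

noncomputable section

namespace Summit.QuantumFields.YangMills.Theorems.Prop7OrbitTransport

open scoped Matrix.Norms.L2Operator
open Literature.MathematicalPhysics.QuantumFieldTheory.Balaban1983to89
open Literature.MathematicalPhysics.QuantumFieldTheory.Balaban1983to89.T3ContinuumYM3Torus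
open Literature.MathematicalPhysics.QuantumFieldTheory.Balaban1983to89.T3UnitLawDensityEML (ℰp)
open Literature.MathematicalPhysics.QuantumFieldTheory.Balaban1983to89.T3ConstrainedMinimiser
open Literature.MathematicalPhysics.QuantumFieldTheory.Balaban1983to89.T3PrintedRegularMinimiser
open Literature.MathematicalPhysics.QuantumFieldTheory.Balaban1983to89.T3PrintedRegularOrbits
open Literature.MathematicalPhysics.QuantumFieldTheory.Balaban1983to89.T3Thm1Carrier
open Literature.MathematicalPhysics.QuantumFieldTheory.Balaban1983to89.T3Thm1CarrierNative
open Literature.MathematicalPhysics.QuantumFieldTheory.Balaban1983to89.T3SectALandauChart (descTransf_inv descTransf_mul descTransf_one)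
open Literature.MathematicalPhysics.QuantumFieldTheory.Balaban1983to89.T3UnitLawGaugeInvariance (gaugeAct_gaugeAct)

/-! ## §1 Equivariance of the carrier's notions under `(V, U) ↦ (V^{u↓}, U^{u})` -/

section Equivariance

variable (F : T3Family) {n K : ℕ} (h : n ≤ K)

/-- `U^{u⁻¹ u} = U`: acting by `u` after `u⁻¹` (pointwise inverse) is the identity. [cite: Balaban1985Averaging, (8) p.19] -/
theorem gaugeAct_gaugeAct_inv_self {P : Params} {j : ℕ} {G : Type*} [GaugeGroup G] (u : GaugeTransf P j G) (U : GaugeField P j G) :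
    GaugeField.gaugeAct u (GaugeField.gaugeAct (fun x => (u x)⁻¹) U) = U := by
  rw [gaugeAct_gaugeAct]
  funext b; simp [GaugeField.gaugeAct]

/-- `U^{u u⁻¹} = U`. [cite: Balaban1985Averaging, (8) p.19] -/
theorem gaugeAct_inv_gaugeAct_self {P : Params} {j : ℕ} {G : Type*} [GaugeGroup G] (u : GaugeTransf P j G) (U : GaugeField P j G) :
    GaugeField.gaugeAct (fun x => (u x)⁻¹) (GaugeField.gaugeAct u U) = U := by
  rw [gaugeAct_gaugeAct]
  funext b; simp [GaugeField.gaugeAct]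

/-- `(u⁻¹)↓ = (u↓)⁻¹` undoes `u↓` on the datum: `(V^{u↓})^{(u⁻¹)↓} = V`. [cite: Balaban1985Averaging, (12)-(13) p.19] -/
theorem gaugeAct_descTransf_inv_self {G : Type*} [GaugeGroup G] (u : GaugeTransf (F.P K) 0 G) (V : GaugeField (F.P n) 0 G) :
    GaugeField.gaugeAct (descTransf F n K h fun x => (u x)⁻¹) (GaugeField.gaugeAct (descTransf F n K h u) V) = V := by
  rw [descTransf_inv]
  exact gaugeAct_inv_gaugeAct_self _ V

/-- **READING R2 IS EQUIVARIANT**: `U^{u}` is critical over `V^{u↓}` iff `U` is critical over `V` (the regular fibres (6)(e) are mapped onto each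
other, `gaugeAct_mem_regFibrePr_iff`, and `A(W^{u}) = A(W)`). [cite: Balaban1985Variational, (4)-(6) p.278] -/
theorem isCritR2_gaugeAct (u : GaugeTransf (F.P K) 0 (Matrix.specialUnitaryGroup (Fin 2) ℂ))
    {V : GaugeField (F.P n) 0 (Matrix.specialUnitaryGroup (Fin 2) ℂ)} {U : GaugeField (F.P K) 0 (Matrix.specialUnitaryGroup (Fin 2) ℂ)}
    (hc : IsCritR2 F n K h V U) : IsCritR2 F n K h (GaugeField.gaugeAct (descTransf F n K h u) V) (GaugeField.gaugeAct u U) := by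
  obtain ⟨e, he, hUe, hmin⟩ := hc
  refine ⟨e, he, (gaugeAct_mem_regFibrePr_iff F h he.le u U V).mpr hUe, fun W hW => ?_⟩
  -- `W = (u⁻¹·W)^{u}` with `u⁻¹·W ∈ (6)(e)(V)`
  have hW' : GaugeField.gaugeAct (fun x => (u x)⁻¹) W ∈ regFibrePr F n K h e V := by
    rw [← gaugeAct_mem_regFibrePr_iff F h he.le u, gaugeAct_gaugeAct_inv_self]
    exact hW
  show wilsonAction4 (GaugeField.gaugeAct u U) ≤ wilsonAction4 W
  rw [show wilsonAction4 (GaugeField.gaugeAct u U) = wilsonAction4 U from T4WilsonGaugeFlatDirection.wilsonAction_gaugeAct 1 u U,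
    show wilsonAction4 W = wilsonAction4 (GaugeField.gaugeAct (fun x => (u x)⁻¹) W) from
      (T4WilsonGaugeFlatDirection.wilsonAction_gaugeAct 1 _ W).symm]
  exact hmin hW'

/-- … as an equivalence. [cite: Balaban1985Variational, (4)-(6) p.278] -/
theorem isCritR2_gaugeAct_iff (u : GaugeTransf (F.P K) 0 (Matrix.specialUnitaryGroup (Fin 2) ℂ))
    (V : GaugeField (F.P n) 0 (Matrix.specialUnitaryGroup (Fin 2) ℂ)) (U : GaugeField (F.P K) 0 (Matrix.specialUnitaryGroup (Fin 2) ℂ)) :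
    IsCritR2 F n K h (GaugeField.gaugeAct (descTransf F n K h u) V) (GaugeField.gaugeAct u U) ↔ IsCritR2 F n K h V U := by
  refine ⟨fun hc => ?_, isCritR2_gaugeAct F h u⟩
  have h1 := isCritR2_gaugeAct F h (fun x => (u x)⁻¹) hc
  rwa [gaugeAct_descTransf_inv_self, gaugeAct_inv_gaugeAct_self] at h1

/-- **PRINT'S GROUP (4) IS NORMALISED BY THE FULL GAUGE GROUP**: if `U′ = U^{v}` with `v↓ = 1`, then `U′^{u} = (U^{u})^{u v u⁻¹}` and `(u v u⁻¹)↓ =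
u↓ v↓ u↓⁻¹ = 1`. [cite: Balaban1985Variational, (4) p.278] -/
theorem sameOrbit_gaugeAct (u : GaugeTransf (F.P K) 0 (Matrix.specialUnitaryGroup (Fin 2) ℂ))
    {U U' : GaugeField (F.P K) 0 (Matrix.specialUnitaryGroup (Fin 2) ℂ)} (hUU' : T3Thm1Carrier.SameOrbit F n K h U U') :
    T3Thm1Carrier.SameOrbit F n K h (GaugeField.gaugeAct u U) (GaugeField.gaugeAct u U') := by
  obtain ⟨v, hv, rfl⟩ := hUU'
  refine ⟨fun x => u x * v x * (u x)⁻¹, ?_, ?_⟩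
  · rw [descTransf_mul, descTransf_mul, descTransf_inv, hv]
    funext x; simp
  · rw [gaugeAct_gaugeAct, gaugeAct_gaugeAct]
    congr 1
    funext x; simp [mul_assoc]

/-- … as an equivalence. [cite: Balaban1985Variational, (4) p.278] -/
theorem sameOrbit_gaugeAct_iff (u : GaugeTransf (F.P K) 0 (Matrix.specialUnitaryGroup (Fin 2) ℂ))
    (U U' : GaugeField (F.P K) 0 (Matrix.specialUnitaryGroup (Fin 2) ℂ)) :
    T3Thm1Carrier.SameOrbit F n K h (GaugeField.gaugeAct u U) (GaugeField.gaugeAct u U') ↔ T3Thm1Carrier.SameOrbit F n K h U U' := by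
  refine ⟨fun hs => ?_, sameOrbit_gaugeAct F h u⟩
  have h1 := sameOrbit_gaugeAct F h (fun x => (u x)⁻¹) hs
  rwa [gaugeAct_inv_gaugeAct_self, gaugeAct_inv_gaugeAct_self] at h1

/-- **READING R1 IS EQUIVARIANT**: `U^{u}` is on a minimal orbit of (6)(e)(V^{u↓}) iff `U` is on one of (6)(e)(V)` (`e ≥ 0`). [cite: Balaban1985Variational, Thm 1 (8) p.279] -/
theorem onMinimalOrbit_gaugeAct {e : ℝ} (he : 0 ≤ e) (u : GaugeTransf (F.P K) 0 (Matrix.specialUnitaryGroup (Fin 2) ℂ))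
    {V : GaugeField (F.P n) 0 (Matrix.specialUnitaryGroup (Fin 2) ℂ)} {U : GaugeField (F.P K) 0 (Matrix.specialUnitaryGroup (Fin 2) ℂ)}
    (hm : (varProblem3 F n K h).OnMinimalOrbit e V U) :
    (varProblem3 F n K h).OnMinimalOrbit e (GaugeField.gaugeAct (descTransf F n K h u) V) (GaugeField.gaugeAct u U) := by
  obtain ⟨hUe, hmin⟩ := hm
  refine ⟨(gaugeAct_mem_regFibrePr_iff F h he u U V).mpr hUe, fun W hW => ?_⟩
  have hW' : GaugeField.gaugeAct (fun x => (u x)⁻¹) W ∈ regFibrePr F n K h e V := by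
    rw [← gaugeAct_mem_regFibrePr_iff F h he u, gaugeAct_gaugeAct_inv_self]
    exact hW
  show wilsonAction4 (GaugeField.gaugeAct u U) ≤ wilsonAction4 W
  rw [show wilsonAction4 (GaugeField.gaugeAct u U) = wilsonAction4 U from T4WilsonGaugeFlatDirection.wilsonAction_gaugeAct 1 u U,
    show wilsonAction4 W = wilsonAction4 (GaugeField.gaugeAct (fun x => (u x)⁻¹) W) from
      (T4WilsonGaugeFlatDirection.wilsonAction_gaugeAct 1 _ W).symm]
  exact hmin hW'

/-- … as an equivalence. [cite: Balaban1985Variational, Thm 1 (8) p.279] -/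
theorem onMinimalOrbit_gaugeAct_iff {e : ℝ} (he : 0 ≤ e) (u : GaugeTransf (F.P K) 0 (Matrix.specialUnitaryGroup (Fin 2) ℂ))
    (V : GaugeField (F.P n) 0 (Matrix.specialUnitaryGroup (Fin 2) ℂ)) (U : GaugeField (F.P K) 0 (Matrix.specialUnitaryGroup (Fin 2) ℂ)) :
    (varProblem3 F n K h).OnMinimalOrbit e (GaugeField.gaugeAct (descTransf F n K h u) V) (GaugeField.gaugeAct u U) ↔
      (varProblem3 F n K h).OnMinimalOrbit e V U := by
  refine ⟨fun hm => ?_, onMinimalOrbit_gaugeAct F h he u⟩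
  have h1 := onMinimalOrbit_gaugeAct F h he (fun x => (u x)⁻¹) hm
  rwa [gaugeAct_descTransf_inv_self, gaugeAct_inv_gaugeAct_self] at h1

end Equivariance

/-! ## §2 The two clauses of Prop. 7 depend on the datum only through its gauge orbit -/

section Clauses

variable (F : T3Family) {n K : ℕ} (h : n ≤ K)

/-- **CLAUSE 1 TRANSPORTS**: at most one critical orbit over `V` ⇒ at most one over `V^{u↓}` (pull the two critical configurations back by `u⁻¹`,
relate them over `V`, push the relation forward). [cite: Balaban1985Variational, Prop. 7 p.299] -/
theorem atMostOneCriticalOrbit_gaugeAct (u : GaugeTransf (F.P K) 0 (Matrix.specialUnitaryGroup (Fin 2) ℂ)) (ε₀ : ℝ)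
    {V : GaugeField (F.P n) 0 (Matrix.specialUnitaryGroup (Fin 2) ℂ)} (hV : (varProblem3 F n K h).AtMostOneCriticalOrbit ε₀ V) :
    (varProblem3 F n K h).AtMostOneCriticalOrbit ε₀ (GaugeField.gaugeAct (descTransf F n K h u) V) := by
  intro U U' hU hB hc hU' hB' hc'
  have hε : 0 ≤ ε₀ := (T3SectALandauChart.pos_of_regPr F hU).le
  -- pull back by `u⁻¹`
  have hUm : RegPr F n K ε₀ (GaugeField.gaugeAct (fun x => (u x)⁻¹) U) := (regPr_gaugeAct_iff F hε _ U).mpr hU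
  have hUm' : RegPr F n K ε₀ (GaugeField.gaugeAct (fun x => (u x)⁻¹) U') := (regPr_gaugeAct_iff F hε _ U').mpr hU'
  have hBm : GaugeField.gaugeAct (fun x => (u x)⁻¹) U ∈ fibre F ℰp n K h V := by
    rw [← gaugeAct_mem_fibre_iff F h ℰp u, gaugeAct_gaugeAct_inv_self]; exact hB
  have hBm' : GaugeField.gaugeAct (fun x => (u x)⁻¹) U' ∈ fibre F ℰp n K h V := by
    rw [← gaugeAct_mem_fibre_iff F h ℰp u, gaugeAct_gaugeAct_inv_self]; exact hB'
  have hcm : IsCritR2 F n K h V (GaugeField.gaugeAct (fun x => (u x)⁻¹) U) := by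
    have h1 := isCritR2_gaugeAct F h (fun x => (u x)⁻¹) hc
    rwa [gaugeAct_descTransf_inv_self] at h1
  have hcm' : IsCritR2 F n K h V (GaugeField.gaugeAct (fun x => (u x)⁻¹) U') := by
    have h1 := isCritR2_gaugeAct F h (fun x => (u x)⁻¹) hc'
    rwa [gaugeAct_descTransf_inv_self] at h1
  have hs := hV _ _ hUm hBm hcm hUm' hBm' hcm'
  have hs' := sameOrbit_gaugeAct F h u hs
  rwa [gaugeAct_gaugeAct_inv_self, gaugeAct_gaugeAct_inv_self] at hs'

/-- **CLAUSE 1 IS GAUGE INVARIANT IN THE DATUM**: at most one critical orbit over `V^{u↓}` iff over `V`. [cite: Balaban1985Variational, Prop. 7 p.299] -/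
theorem atMostOneCriticalOrbit_gaugeAct_iff (u : GaugeTransf (F.P K) 0 (Matrix.specialUnitaryGroup (Fin 2) ℂ)) (ε₀ : ℝ)
    (V : GaugeField (F.P n) 0 (Matrix.specialUnitaryGroup (Fin 2) ℂ)) :
    (varProblem3 F n K h).AtMostOneCriticalOrbit ε₀ (GaugeField.gaugeAct (descTransf F n K h u) V) ↔
      (varProblem3 F n K h).AtMostOneCriticalOrbit ε₀ V := by
  refine ⟨fun hV => ?_, atMostOneCriticalOrbit_gaugeAct F h u ε₀⟩
  have h1 := atMostOneCriticalOrbit_gaugeAct F h (fun x => (u x)⁻¹) ε₀ hV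
  rwa [gaugeAct_descTransf_inv_self] at h1

/-- **CLAUSE 2 IS GAUGE INVARIANT IN THE DATUM**: a minimal orbit in (6)(e)(V^{u↓}) exists iff one in (6)(e)(V) does (`e ≥ 0`). [cite: Balaban1985Variational, Prop. 7 p.299] -/
theorem exists_onMinimalOrbit_gaugeAct_iff {e : ℝ} (he : 0 ≤ e) (u : GaugeTransf (F.P K) 0 (Matrix.specialUnitaryGroup (Fin 2) ℂ))
    (V : GaugeField (F.P n) 0 (Matrix.specialUnitaryGroup (Fin 2) ℂ)) :
    (∃ U, (varProblem3 F n K h).OnMinimalOrbit e (GaugeField.gaugeAct (descTransf F n K h u) V) U) ↔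
      ∃ U, (varProblem3 F n K h).OnMinimalOrbit e V U := by
  constructor
  · rintro ⟨U, hU⟩
    refine ⟨GaugeField.gaugeAct (fun x => (u x)⁻¹) U, ?_⟩
    rw [← onMinimalOrbit_gaugeAct_iff F h he u, gaugeAct_gaugeAct_inv_self]
    exact hU
  · rintro ⟨U, hU⟩
    exact ⟨_, onMinimalOrbit_gaugeAct F h he u hU⟩

/-- Clause 1 for every COARSE gauge transformation `w` of the datum (through the lift `liftTransfTo`, `(lift w)↓ = w`). [cite: Balaban1985Variational, Prop. 7 p.299] -/
theorem atMostOneCriticalOrbit_coarse_iff (w : GaugeTransf (F.P n) 0 (Matrix.specialUnitaryGroup (Fin 2) ℂ)) (ε₀ : ℝ)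
    (V : GaugeField (F.P n) 0 (Matrix.specialUnitaryGroup (Fin 2) ℂ)) :
    (varProblem3 F n K h).AtMostOneCriticalOrbit ε₀ (GaugeField.gaugeAct w V) ↔ (varProblem3 F n K h).AtMostOneCriticalOrbit ε₀ V := by
  have h1 := atMostOneCriticalOrbit_gaugeAct_iff F h (liftTransfTo F n K h w) ε₀ V
  rwa [descTransf_liftTransfTo] at h1

/-- Clause 2 for every COARSE gauge transformation `w` of the datum. [cite: Balaban1985Variational, Prop. 7 p.299] -/
theorem exists_onMinimalOrbit_coarse_iff {e : ℝ} (he : 0 ≤ e) (w : GaugeTransf (F.P n) 0 (Matrix.specialUnitaryGroup (Fin 2) ℂ))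
    (V : GaugeField (F.P n) 0 (Matrix.specialUnitaryGroup (Fin 2) ℂ)) :
    (∃ U, (varProblem3 F n K h).OnMinimalOrbit e (GaugeField.gaugeAct w V) U) ↔ ∃ U, (varProblem3 F n K h).OnMinimalOrbit e V U := by
  have h1 := exists_onMinimalOrbit_gaugeAct_iff F h he (liftTransfTo F n K h w) V
  rwa [descTransf_liftTransfTo] at h1

end Clauses

/-! ## §3 Both clauses at every pure-gauge datum `V = 1^{w}` -/

section PureGauge

/-- **BOTH CLAUSES OF [7] PROP. 7 AT EVERY PURE-GAUGE DATUM `V = 1^{w}`** of every member of the T³ family, for every `ε₀` and every radius `e > 0`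
(transport of `Prop7FlatDatum.prop7_clauses_flatDatum`). [cite: Balaban1985Variational, Prop. 7 p.299] -/
theorem prop7_clauses_pureGauge {L : ℕ} (i : Idx L)
    (w : GaugeTransf (i.1.1.P i.1.2.1) 0 (Matrix.specialUnitaryGroup (Fin 2) ℂ)) (ε₀ e : ℝ) (he : 0 < e) :
    (famX L i).AtMostOneCriticalOrbit ε₀
        (GaugeField.gaugeAct w (1 : GaugeField (i.1.1.P i.1.2.1) 0 (Matrix.specialUnitaryGroup (Fin 2) ℂ))) ∧
      ∃ U : (famX L i).Cfg, (famX L i).OnMinimalOrbit e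
        (GaugeField.gaugeAct w (1 : GaugeField (i.1.1.P i.1.2.1) 0 (Matrix.specialUnitaryGroup (Fin 2) ℂ))) U := by
  obtain ⟨h1, h2⟩ := Prop7FlatDatum.prop7_clauses_flatDatum i ε₀ e he
  obtain ⟨⟨F, n, K⟩, hF, hnK⟩ := i
  exact ⟨(atMostOneCriticalOrbit_coarse_iff F hnK.le w ε₀ 1).mpr h1, (exists_onMinimalOrbit_coarse_iff F hnK.le he.le w 1).mpr h2⟩

/-- **THE REGISTERED STUB `stub_prop7From14` SPECIALISED TO THE PURE-GAUGE DATA `V = 1^{w}`, verbatim binders** (constants `a₀ = a₁′ = O₁ = 1`;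
no smallness used). [cite: Balaban1985Variational, Prop. 7 p.299] -/
theorem prop7From14_pureGaugeDatum : ∀ (L : ℕ), 1 < L → ∀ B₃ : ℝ, 4 < B₃ →
    ∃ a₀ a₁' O₁ : ℝ, 0 < a₀ ∧ 0 < a₁' ∧ 1 ≤ O₁ ∧ ∀ (i : Idx L) (w : GaugeTransf (i.1.1.P i.1.2.1) 0 (Matrix.specialUnitaryGroup (Fin 2) ℂ))
      (ε₀ ε₁ : ℝ), 0 < ε₁ →
      (famX L i).Reg7 ε₁ (GaugeField.gaugeAct w (1 : GaugeField (i.1.1.P i.1.2.1) 0 (Matrix.specialUnitaryGroup (Fin 2) ℂ))) →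
      ∀ U₀ : (famX L i).Cfg, (famX L i).InU ((L : ℝ) ^ 3 * B₃ * ε₁) U₀ →
        (famX L i).InB (GaugeField.gaugeAct w (1 : GaugeField (i.1.1.P i.1.2.1) 0 (Matrix.specialUnitaryGroup (Fin 2) ℂ))) U₀ →
        (ε₀ ≤ a₀ → B₃ * ε₁ ≤ ε₀ → (famX L i).AtMostOneCriticalOrbit ε₀
          (GaugeField.gaugeAct w (1 : GaugeField (i.1.1.P i.1.2.1) 0 (Matrix.specialUnitaryGroup (Fin 2) ℂ)))) ∧
        (ε₁ ≤ a₁' → ∃ U : (famX L i).Cfg, (famX L i).OnMinimalOrbit (O₁ * (L : ℝ) ^ 3 * B₃ * ε₁)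
          (GaugeField.gaugeAct w (1 : GaugeField (i.1.1.P i.1.2.1) 0 (Matrix.specialUnitaryGroup (Fin 2) ℂ))) U) := by
  intro L hL B₃ hB₃
  refine ⟨1, 1, 1, one_pos, one_pos, le_rfl, fun i w ε₀ ε₁ hε₁ _ U₀ _ _ => ?_⟩
  have he : 0 < 1 * (L : ℝ) ^ 3 * B₃ * ε₁ := by
    have hL0 : (0 : ℝ) < L := by exact_mod_cast (zero_lt_one.trans hL)
    have hB : (0 : ℝ) < B₃ := by linarith
    positivity
  obtain ⟨h1, h2⟩ := prop7_clauses_pureGauge i w ε₀ _ he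
  exact ⟨fun _ _ => h1, fun _ => h2⟩

end PureGauge

end Summit.QuantumFields.YangMills.Theorems.Prop7OrbitTransport

end
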